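import Literature.MathematicalPhysics.QuantumFieldTheory.Balaban1983to89.B7Prop2Rec
import Literature.MathematicalPhysics.QuantumFieldTheory.Balaban1983to89.B7Prop2SpecialUnitary

/-!
# `Balaban1983to89.B7Prop2SpecialUnitaryRec` — [Balaban1985Averaging] p. 20 («the group `G` is obtained by applying the function `e^{iA}` to `A ∈ 𝔤`») FOR `G = SU(N)`
# AND THE RECORD's AVERAGING STRUCTURE ([Balaban1987RG1] (0.4)): the symmetric loop average of an `SU(N)`-valued field is `SU(N)`-valued at radius `t ≤ 1∕4` with `Nt < π`,
# so `SU(N)` is `AvgClosedZ` for `N ≤ 12` — the LOCATE L2 item of the «N05-REC» road (`N05-REC-LEAD.md` §4), i.e. the SU-membership of the gauge of the R6 crown for physical `N`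

statement-level skeleton of published theorems with citation tags; proofs where landed; nothing here is a claim about the Yang–Mills mass gap

CITATION HEADER (lean-in-tree rule).  Cell `pub-ymgap` (HUMAN RULING D-0062), «N05-REC» road (director-ym №254∕№255; LEAD PEN dag-n05-e g37; desk `R6-PLAN.md` §0 «SU-vs-unitary»;
`N05-REC-LEAD.md` §4 LOCATE L2; ref-A g39's A2 note on the n05-e tranche: «the SU(N) closure at the record radius is explicitly NOT in the tree»).  [3] = [Balaban1985Averaging] p. 20, (20)–(23)
p. 21, (42)–(43) pp. 23–24 (`paper:balaban1985-cmp98-averaging`); [I] = [Balaban1987RG1] (0.4) p. 253.  `--kind proof --supports stmt-QuantumFields-20541` (K0⁷; count-neutral; no definition).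
REUSED BY NAME: the engine's `B7Prop2SpecialUnitary.{specialUnitaryUnits, specialUnitaryUnits_le_unitaryUnits, specialUnitaryUnits_le_U1}` (the subgroup `SU(N) ≤ M_N(ℂ)ˣ`),
`ExpMeanLog.trace_mlog_eq_zero` (`Tr log W = 0` for `W ∈ SU(N)` near `1` with `N|W − 1| < π`), `Literature.Analysis.Matrix.det_exp_eq_exp_trace`; the record's `B7Prop2Rec.{AvgClosedZ,
bavgZ_mem_unitaryUnits}`, `BlockAveragingZd.{WZ, XZ, bavgZ}`.  The NEGATIVE side is the engine's and applies verbatim in spirit (`B7Prop2SpecialUnitary.not_avgClosed_specialUnitary`: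
for `N ≥ 26` the corner average at radius `1∕4` leaves `SU(N)`; the same twisted configuration defeats any log-mean average) — so the restriction on `N` below is genuine, not an artefact.

WHAT IS PROVED (sorry-free).  ★ `bavgZ_mem_specialUnitaryUnits` — the record's one-step average (0.4) `V̄_c = e^{X_c}V(c)`, `X_c =` the uniform mean of `log W_i` over the loop family, of an
`SU(N)`-valued `V` is `SU(N)`-valued as soon as every loop variable `W_i` is within `t ≤ 1∕4` of `1` and `N·t < π` (`det e^{X_c} = e^{Tr X_c} = e^{mean Tr log W_i} = 1`);
★★ `avgClosedZ_specialUnitary` — **`AvgClosedZ d L (SU(N))` for `N ≤ 12`** (radius `1∕4`: `12∕4 = 3 < π`), the hypothesis `hG` of every k-uniform record theorem of the N05-REC tranche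
(`B7Prop4GeneralLevelsRec`, `B7Eq123GeneralRec`, `B8Eq131CubesRec.ineq132_cubes`, `B8Prop6OfThm4Rec.prop6_of_thm4`, …) at `G = SU(N)`, in particular for `SU(2)`, `SU(3)`.
HONEST SCOPE.  Group-membership bookkeeping; no estimate; for `13 ≤ N ≤ 25` the closure at radius `1∕4` still holds but needs the sharper trace argument of `B7AvgClosedSpecialUnitarySharp`
(not re-run here); for `N ≥ 26` it is FALSE (engine §5).  Nothing of [3]∕[I] asserted beyond this; `HThm4Rec` UNDISCHARGED; N05 ∕ N07 NOT discharged; counts unmoved (typed 28∕28 ·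
discharged 8∕28); one finite 𝕋⁴ programme at fixed ε — nothing continuum ∕ ℝ⁴ ∕ OS ∕ mass gap ∕ Clay.  No `def`, no `instance`, no `notation`, no `sorry`.
-/

set_option autoImplicit false

noncomputable section

open scoped BigOperators
open NormedSpace Finset

namespace Literature.MathematicalPhysics.QuantumFieldTheory.Balaban1983to89.B7Prop2SpecialUnitaryRec

open B7Prop1Explicit hiding Site
open B7Prop1Explicit renaming Site → SiteZ
open B7Prop2Explicit (unitaryUnits mem_unitaryUnits unitaryUnits_le_U1 hol_mem_of)
open MatrixLog
open BlockAveragingZd (IdxZ WZ WZ_def XZ bavgZ bavgZ_apply)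
open B7Prop2Rec (AvgClosedZ bavgZ_mem_unitaryUnits)
open B7Prop2SpecialUnitary (specialUnitaryUnits mem_specialUnitaryUnits specialUnitaryUnits_le_unitaryUnits specialUnitaryUnits_le_U1)

variable {d : ℕ}
variable {n : Type*} [Fintype n] [DecidableEq n]

open scoped Matrix.Norms.L2Operator

/-- ★ (RECORD TWIN of `B7Prop2SpecialUnitary.bavg_mem_specialUnitaryUnits`.) **The record's one-step average (0.4) of an `SU(N)`-valued configuration is `SU(N)`-valued at radius
`t ≤ 1∕4`, `N·t < π`**: every loop variable `W_i = V(Γ ∪ [x, x′] ∪ (−Γ′) ∪ (−c)) ∈ SU(N)` (a product of bond variables) with `|W_i − 1| ≤ t`, so `V̄_c = e^{X_c}V(c)` is unitary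
(`B7Prop2Rec.bavgZ_mem_unitaryUnits`) and `det V̄_c = e^{Tr X_c}·det V(c) = exp[mean_i Tr log W_i] = e^0 = 1` (`ExpMeanLog.trace_mlog_eq_zero`).  The hypothesis `N·t < π` cannot be dropped
(engine §5). [cite: Balaban1985Averaging, p.20, (20)–(23) p.21, (42) p.23; Balaban1987RG1, (0.4) p.253] -/
theorem bavgZ_mem_specialUnitaryUnits {V : SiteZ d → Fin d → (Matrix n n ℂ)ˣ}
    (hV : ∀ x κ, V x κ ∈ specialUnitaryUnits n) (L : ℕ) (q : SiteZ d) (κ : Fin d) {t : ℝ} (ht4 : t ≤ 1 / 4)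
    (htπ : Fintype.card n * t < Real.pi)
    (hW : ∀ i : IdxZ d L, ‖((WZ L V q κ i : (Matrix n n ℂ)ˣ) : Matrix n n ℂ) - 1‖ ≤ t) :
    bavgZ L V q κ ∈ specialUnitaryUnits n := by
  letI : CStarAlgebra (Matrix n n ℂ) := {}
  have hVU : ∀ x κ, V x κ ∈ unitaryUnits (Matrix n n ℂ) := fun x κ =>
    specialUnitaryUnits_le_unitaryUnits (hV x κ)
  have hU : bavgZ L V q κ ∈ unitaryUnits (Matrix n n ℂ) :=
    bavgZ_mem_unitaryUnits hVU L q κ fun i => (hW i).trans ht4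
  have hWm : ∀ i : IdxZ d L, WZ L V q κ i ∈ specialUnitaryUnits n := fun i => by
    rw [WZ_def]; exact hol_mem_of hV _ _
  have htr : ∀ i : IdxZ d L, (mlog ((WZ L V q κ i : (Matrix n n ℂ)ˣ) : Matrix n n ℂ)).trace = 0 := fun i =>
    ExpMeanLog.trace_mlog_eq_zero (hWm i) ((hW i).trans (ht4.trans (by norm_num)))
      ((mul_le_mul_of_nonneg_left (hW i) (Nat.cast_nonneg _)).trans_lt htπ)
  have hX : (XZ L V q κ).trace = 0 := by
    unfold XZ
    rw [Matrix.trace_sum]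
    exact Finset.sum_eq_zero fun i _ => by rw [Matrix.trace_smul, htr i, smul_zero]
  have hdet : ((hol V q (seg κ L) : (Matrix n n ℂ)ˣ) : Matrix n n ℂ).det = 1 :=
    (Matrix.mem_specialUnitaryGroup_iff.1 (hol_mem_of hV q (seg κ L))).2
  rw [mem_specialUnitaryUnits, Matrix.mem_specialUnitaryGroup_iff]
  refine ⟨hU, ?_⟩
  rw [bavgZ_apply, Units.val_mul, Matrix.det_mul, hdet, mul_one, val_expUnit,
    Literature.Analysis.Matrix.det_exp_eq_exp_trace, hX, exp_zero]

variable [Nonempty n]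

variable (d) in
/-- ★★ **`SU(N)` IS `AvgClosedZ` FOR `N ≤ 12`** — the record's Prop-2 closure hypothesis (`B7Prop2Rec.AvgClosedZ`, radius `1∕4`) holds for the special unitary group whenever `N∕4 < π`,
in particular for `SU(2)` and `SU(3)`: the `hG` of the N05-REC tranche's k-uniform theorems at `G = SU(N)`, hence the SU-membership of the R6 crown's gauge transformations for physical
`N` (LOCATE L2 of the road).  For `N ≥ 26` this is false (engine `not_avgClosed_specialUnitary`). [cite: Balaban1985Averaging, p.20, (42)–(43) pp.23–24; Balaban1987RG1, (0.4) p.253] -/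
theorem avgClosedZ_specialUnitary (L : ℕ) (hN : Fintype.card n ≤ 12) : AvgClosedZ d L (specialUnitaryUnits n) := by
  have hπ : (Fintype.card n : ℝ) * (1 / 4) < Real.pi := by
    have h12 : (Fintype.card n : ℝ) ≤ 12 := by exact_mod_cast hN
    have hpi : (3 : ℝ) < Real.pi := Real.pi_gt_three
    linarith
  exact ⟨specialUnitaryUnits_le_U1, fun _ hV q κ hW => bavgZ_mem_specialUnitaryUnits hV _ q κ le_rfl hπ hW⟩

end Literature.MathematicalPhysics.QuantumFieldTheory.Balaban1983to89.B7Prop2SpecialUnitaryRec
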